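import Summits.HodgeConjecture.HodgeConjecture.Theorems.F0P6aStubDOWNTransport
import HarnessLib

/-!
# `F0P6aStubDOWN` — ★ RE-HOME of `Lines/F0_P6a_StubDOWN.lean`, PART 7 of 7 (size-lint split; cut at a declaration boundary).

Imports: ★ `Theorems.F0P6aStubDOWNTransport` = the previous part of the same Lines workfile `F0_P6a_StubDOWN` (size-lint split ×7) + `HarnessLib` (canonical header: bare `import` lines).
See PART 1 `Theorems/F0P6aStubDOWNLaws.lean` for the full re-home header and the original module docstring (verbatim there). Namespaces and sections KEPT
(re-opened below exactly as they stand at the cut, with their `open`∕`variable` lines replayed); code bytes = the workfile՚s, docstrings included; options preamble repeated from PART 1.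
HC_CM is proved only modulo the 7 printed citations (2 remaining: hLiu418 = stmt-HodgeConjecture-24832, h413 = stmt-HodgeConjecture-24833) until rung 0 closes; a re-home is count-neutral. -/

set_option autoImplicit false
set_option linter.dupNamespace false

noncomputable section

namespace Summit.HodgeConjecture.HodgeConjecture.Cruxes.HLiu418.F0P6aStubDOWN
open CategoryTheory CategoryTheory.Limits NumberField IsDedekindDomain MulAction
open scoped Matrix Polynomial Pointwise MonoidalCategory
open Literature.NumberTheory.GaloisRepresentations
open Literature.NumberTheory.Automorphic Literature.NumberTheory.Automorphic.UnitaryGroup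
open Literature.AlgebraicGeometry.ShimuraVarieties.UnitaryCanonicalModel
open Literature.NumberTheory.Automorphic.Liu2021.AppendixC
open Literature.AlgebraicGeometry.Motives (AlgPoints IntegralModel SchemeOver thickening thickeningGalAction thickeningLift specOver relFrobeniusOver frobeniusTwistOver)
open Literature.NumberTheory.DiophantineGeometry (geomResidueField specialFibreFunctor specResidueField)
open Literature.AlgebraicGeometry.RelativeSpec (ActionOver)
open Literature.NumberTheory.EllipticCurves (genericFibre)
open Literature.AlgebraicGeometry.GroupSchemes.AffineGroupScheme (Alg quotIncl)
open Summit.HodgeConjecture.HodgeConjecture.Cruxes.HLiu418.F0P6cDictConstructors (kerFI AdmSub IdealIsEtale isAdm_kerFI)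
open Summit.HodgeConjecture.HodgeConjecture.Cruxes.HLiu418.F0P6aModuliDatumDefs
open Summit.HodgeConjecture.HodgeConjecture.Cruxes.HLiu418.F0P6aRGDAssembly
open Summit.HodgeConjecture.HodgeConjecture.Cruxes.HLiu418.F0P6aDatumOfInputs
open Summit.HodgeConjecture.HodgeConjecture.Cruxes.HLiu418.F0P6aLineSpecialisation (spGeoOf canonicalLine_spGeoOf spGeoOf_surjective hrkG_of_dock
  exists_isogW₀_of_quotLeg mono_coverPin₀ le_ker_isogW₀_of_himg red₀Of_translΩ_eq_of_red₀Of_eq red₀Of_quotΩ_eq_red₀Of_translΩ_of_le_ker_layer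
  red₀Of_quotΩ_eq_of_quotLegReduction₀)  -- [ED. 4] organ heads BY NAME (incl. the §Q head `red₀Of_quotΩ_eq_of_quotLegReduction₀`, PART B)

section Machinery
open scoped MonObj Obj
variable {F : Type} [Field F] [NumberField F] [IsCMField F] {ι₁ : F →+* ℂ}
    {Jstar : Matrix (Fin 2) (Fin 2) F}
    {K₀ : C5.OpenCompactSubgroup ↥(finAdelic ↥(maximalRealSubfield F) F (IsCMField.complexConj F) 2 Jstar)}
    {S : RecordSystemGS F Jstar ι₁ K₀} {hU7ₛ : S.HeckeTranslateDefinedOver}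
    {hJ : (Jstar.map (IsCMField.complexConj F))ᵀ = Jstar} {hJu : IsUnit Jstar}
    {Fi : Type} [Field Fi] [Algebra F Fi] {Kc : C5.SmallLevel K₀} {G : Type} [Group G]
    {𝓜 : IntegralModel (𝓞 F) F ((thickening F Fi).obj (S.M.obj Kc))}
    {w : HeightOneSpectrum (𝓞 F)} {hw : (IsCMField.complexConj F) • w ≠ w} {h𝓨 : (𝓜.localise w).IsSmoothProper 1}
    {θ : ActionOver (𝓜.localise w).total.hom ((Fi ≃ₐ[F] Fi) × G)}
    {e : Fi →ₐ[F] AlgebraicClosure (w.adicCompletion F)}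
variable (hsheets : SheetDecompLaw S Kc 𝓜 w h𝓨 θ e)
variable (I : RGDInputsAt F ι₁ Jstar K₀ S hU7ₛ hJ hJu Fi Kc G 𝓜 w hw h𝓨 θ e) [ExpChar (geomResidueField w) I.pChar] (𝔡 : ∀ xbar, DockAt I xbar)
variable (hiso : LayerIsoLaw I 𝔡)
variable (quot : ∀ xbar, SubOf I 𝔡 xbar → AlgPoints (𝓜.localise w).reductionAt (geomResidueField w))
  (transl : AlgPoints (𝓜.localise w).reductionAt (geomResidueField w) → AlgPoints (𝓜.localise w).reductionAt (geomResidueField w))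
  (isogW₀ : ∀ xbar (H : SubOf I 𝔡 xbar), (𝔡 xbar).G₀ ⟶ (𝔡 (quot xbar H)).G₀)


set_option maxHeartbeats 400000 in
/-- **K-DATA ROW `IsogKerLaw`** for the transported layer maps `isogW₀′ = isogT`: the named-arrow form `isogKerLaw_transport_of_eq` at
`k := isogT x̄ H` (`rfl`), with EVERY point spelled exactly as in the bodies of `quotT`∕`isogT` (`b := actOf (τOf x̄)⁻¹ x̄`, `q := quot b (pull H)`,
`q′ := quotT x̄ H`) — so the kernel՚s re-check of the law body is letter-identical (a `≫`∕`1`-headed comparison that differs in ANY implicit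
object spelling makes the kernel descend the `Over (Spec κ) → Scheme → LRS` composition tower; measured > 600 s). [cite: Liu2021, p. 137] -/
theorem isogKerLaw_isogT (hker : IsogKerLaw I 𝔡 quot isogW₀) : IsogKerLaw I 𝔡 (quotT hsheets I 𝔡 hiso quot) (isogT hsheets I 𝔡 hiso quot isogW₀) := by
  intro xbar H
  exact isogKerLaw_transport_of_eq (a := xbar) (b := actOf S Kc 𝓜 w θ (τOf hsheets xbar)⁻¹ xbar)
    (q := quot (actOf S Kc 𝓜 w θ (τOf hsheets xbar)⁻¹ xbar) (pullOf hsheets I 𝔡 hiso xbar H)) (q' := quotT hsheets I 𝔡 hiso quot xbar H) I 𝔡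
    (layerIso I 𝔡 hiso (τOf hsheets xbar)⁻¹ xbar)
    (isogW₀ (actOf S Kc 𝓜 w θ (τOf hsheets xbar)⁻¹ xbar) (pullOf hsheets I 𝔡 hiso xbar H))
    (layerIso I 𝔡 hiso (τOf hsheets xbar) (quot (actOf S Kc 𝓜 w θ (τOf hsheets xbar)⁻¹ xbar) (pullOf hsheets I 𝔡 hiso xbar H)))
    (isMonHom_layerIso I 𝔡 hiso (τOf hsheets xbar) (quot (actOf S Kc 𝓜 w θ (τOf hsheets xbar)⁻¹ xbar) (pullOf hsheets I 𝔡 hiso xbar H))) H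
    (pullOf hsheets I 𝔡 hiso xbar H)
    (transportSub_val I 𝔡 (layerIso I 𝔡 hiso (τOf hsheets xbar)⁻¹ xbar) (isMonHom_layerIso I 𝔡 hiso (τOf hsheets xbar)⁻¹ xbar)
      (layerIso_comm I 𝔡 hiso (τOf hsheets xbar)⁻¹ xbar) H)
    (hker (actOf S Kc 𝓜 w θ (τOf hsheets xbar)⁻¹ xbar) (pullOf hsheets I 𝔡 hiso xbar H))
    (isogT hsheets I 𝔡 hiso quot isogW₀ xbar H) rfl

set_option maxHeartbeats 400000 in
/-- **THE SECOND POINT IS ON THE SHEET**: `quot (red₀ y) H₀ = red₀ y₁` for some `y₁` (`SpSurjLaw` + `RedQuotLaw`). [cite: Liu2021, p. 137] -/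
theorem exists_quot_red₀Of_eq
    {quotΩ : ∀ y, LineOf I y → AlgPoints (S.M.obj Kc) (AlgebraicClosure (w.adicCompletion F))}
    {sp : ∀ y, LineOf I y → SubOf I 𝔡 (red₀Of S Kc 𝓜 w h𝓨 e y)}
    (hrq : RedQuotLaw I 𝔡 quotΩ sp quot) (hsurj : SpSurjLaw I 𝔡 sp)
    (y : AlgPoints (S.M.obj Kc) (AlgebraicClosure (w.adicCompletion F))) (H₀ : SubOf I 𝔡 (red₀Of S Kc 𝓜 w h𝓨 e y)) :
    ∃ y₁, quot (red₀Of S Kc 𝓜 w h𝓨 e y) H₀ = red₀Of S Kc 𝓜 w h𝓨 e y₁ := by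
  obtain ⟨L, hL⟩ := hsurj y H₀
  exact ⟨quotΩ y L, by rw [← hL, hrq y L]⟩

set_option maxHeartbeats 400000 in
/-- The same at a point KNOWN to be on the sheet (`b = red₀ y`, generalised for `subst`). [cite: Liu2021, p. 137] -/
theorem exists_quot_eq_red₀Of_of_eq
    {quotΩ : ∀ y, LineOf I y → AlgPoints (S.M.obj Kc) (AlgebraicClosure (w.adicCompletion F))}
    {sp : ∀ y, LineOf I y → SubOf I 𝔡 (red₀Of S Kc 𝓜 w h𝓨 e y)}
    (hrq : RedQuotLaw I 𝔡 quotΩ sp quot) (hsurj : SpSurjLaw I 𝔡 sp)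
    {b : AlgPoints (𝓜.localise w).reductionAt (geomResidueField w)} {y : AlgPoints (S.M.obj Kc) (AlgebraicClosure (w.adicCompletion F))}
    (hb : b = red₀Of S Kc 𝓜 w h𝓨 e y) (H₀ : SubOf I 𝔡 b) : ∃ y₁, quot b H₀ = red₀Of S Kc 𝓜 w h𝓨 e y₁ := by
  subst hb
  exact exists_quot_red₀Of_eq I 𝔡 quot hrq hsurj y H₀

set_option maxHeartbeats 400000 in
/-- KERNEL BOOKKEEPING ALONG ISOMORPHISMS (generic): `J ≤ ker Γ(φ₁ ≫ g ≫ ψ₁)` ⟹ `Γ(ψ₁⁻¹)⁻¹ J ≤ ker Γ(g)` for isomorphisms `φ₁`, `ψ₁`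
(`Γ(φ₁)` is injective, `Γ(ψ₁) ∘ Γ(ψ₁⁻¹) = id`; ★ `appTop_inv_appTop_hom_apply`, `appTop_hom_appTop_inv_apply`). [cite: GortzWedhorn2023, §(27.2) (p. 606)] -/
theorem comap_le_ker_of_le_ker_comp {k : Type} [Field k] {A A' B B' : SchemeOver k} (φ₁ : A' ≅ A) (g : A ⟶ B) (ψ₁ : B ≅ B')
    (J : Ideal (Alg B')) (hJ : J ≤ (RingHom.ker (φ₁.hom ≫ g ≫ ψ₁.hom).left.appTop.hom : Ideal (Alg B'))) :
    (J.comap ψ₁.inv.left.appTop.hom : Ideal (Alg B)) ≤ (RingHom.ker g.left.appTop.hom : Ideal (Alg B)) := by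
  intro x hx
  have h0 : (φ₁.hom ≫ g ≫ ψ₁.hom).left.appTop.hom (ψ₁.inv.left.appTop.hom x) = 0 := hJ (Ideal.mem_comap.mp hx)
  rw [Over.comp_left, Over.comp_left, AlgebraicGeometry.Scheme.Hom.comp_appTop, AlgebraicGeometry.Scheme.Hom.comp_appTop,
    CommRingCat.hom_comp, CommRingCat.hom_comp, RingHom.comp_apply, RingHom.comp_apply,
    Literature.AlgebraicGeometry.GroupSchemes.AdmIdealTransport.appTop_hom_appTop_inv_apply] at h0
  have h1 := congrArg φ₁.inv.left.appTop.hom h0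
  rw [Literature.AlgebraicGeometry.GroupSchemes.AdmIdealTransport.appTop_inv_appTop_hom_apply, map_zero] at h1
  exact h1

set_option maxHeartbeats 400000 in
/-- **THE SHEET INDEX OF THE SECOND POINT: `τOf (quot′ x̄ H) = τOf x̄`** (the inner quotient `quot (base x̄) (pull H)` is on the sheet by `SpSurjLaw` +
`RedQuotLaw`, then §B uniqueness). [cite: Liu2021, p. 137] -/
theorem τOf_quotT (hdisj : SheetDisjoint S Kc 𝓜 w h𝓨 θ e)
    {quotΩ : ∀ y, LineOf I y → AlgPoints (S.M.obj Kc) (AlgebraicClosure (w.adicCompletion F))}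
    {sp : ∀ y, LineOf I y → SubOf I 𝔡 (red₀Of S Kc 𝓜 w h𝓨 e y)}
    (hrq : RedQuotLaw I 𝔡 quotΩ sp quot) (hsurj : SpSurjLaw I 𝔡 sp)
    (xbar : AlgPoints (𝓜.localise w).reductionAt (geomResidueField w)) (H : SubOf I 𝔡 xbar) :
    τOf hsheets (quotT hsheets I 𝔡 hiso quot xbar H) = τOf hsheets xbar := by
  obtain ⟨y₁, hy₁⟩ := exists_quot_eq_red₀Of_of_eq I 𝔡 quot hrq hsurj (base_eq_red₀Of_yOf hsheets xbar) (pullOf hsheets I 𝔡 hiso xbar H)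
  have h1 : τOf hsheets (quotT hsheets I 𝔡 hiso quot xbar H) =
      τOf hsheets xbar * τOf hsheets (quot (base hsheets xbar) (pullOf hsheets I 𝔡 hiso xbar H)) :=
    τOf_actOf hsheets hdisj _ _
  rw [h1, hy₁, τOf_red₀Of hsheets hdisj, mul_one]

set_option maxHeartbeats 400000 in
/-- **D6 ROW `QuotQuot₀Law`** for the transported readings: D6 at the representative `base x̄` (law `_hqq`, whose second point is on the sheet), transported by
`θ(τOf x̄, 1)_s`; the kernel hypothesis moves along the layer iso `ψ₁` (`comap_le_ker_of_le_ker_comp`). [cite: Liu2021, Prop. D.8 (2) p. 135, p. 137] -/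
theorem quotQuot₀Law_quotT (hdisj : SheetDisjoint S Kc 𝓜 w h𝓨 θ e)
    {quotΩ : ∀ y, LineOf I y → AlgPoints (S.M.obj Kc) (AlgebraicClosure (w.adicCompletion F))}
    {sp : ∀ y, LineOf I y → SubOf I 𝔡 (red₀Of S Kc 𝓜 w h𝓨 e y)}
    (hrq : RedQuotLaw I 𝔡 quotΩ sp quot) (hsurj : SpSurjLaw I 𝔡 sp) (hqq : QuotQuot₀Law I 𝔡 quot transl isogW₀) :
    QuotQuot₀Law I 𝔡 (quotT hsheets I 𝔡 hiso quot) (translT hsheets transl) (isogT hsheets I 𝔡 hiso quot isogW₀) := by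
  intro xbar H H' hH'
  letI := (𝔡 xbar).grp₀; letI := (𝔡 (base hsheets xbar)).grp₀
  letI := (𝔡 (quot (base hsheets xbar) (pullOf hsheets I 𝔡 hiso xbar H))).grp₀
  letI := (𝔡 (quotT hsheets I 𝔡 hiso quot xbar H)).grp₀; haveI := (𝔡 (quotT hsheets I 𝔡 hiso quot xbar H)).aff₀
  have hσ : τOf hsheets (quotT hsheets I 𝔡 hiso quot xbar H) = τOf hsheets xbar := τOf_quotT hsheets I 𝔡 hiso quot hdisj hrq hsurj xbar H
  have hb : actOf S Kc 𝓜 w θ (τOf hsheets xbar)⁻¹ (quotT hsheets I 𝔡 hiso quot xbar H) =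
      quot (base hsheets xbar) (pullOf hsheets I 𝔡 hiso xbar H) := actOf_inv_actOf _ _
  have key := quotT_eq_of hsheets I 𝔡 hiso quot _ hσ hb
    (layerIso I 𝔡 hiso (τOf hsheets xbar) (quot (base hsheets xbar) (pullOf hsheets I 𝔡 hiso xbar H))).symm
    (isMonHom_layerIso_inv I 𝔡 hiso _ _) (layerIso_inv_comm I 𝔡 hiso _ _) H'
  have hker' := comap_le_ker_of_le_ker_comp (layerIso I 𝔡 hiso (τOf hsheets xbar)⁻¹ xbar)
    (isogW₀ (base hsheets xbar) (pullOf hsheets I 𝔡 hiso xbar H))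
    (layerIso I 𝔡 hiso (τOf hsheets xbar) (quot (base hsheets xbar) (pullOf hsheets I 𝔡 hiso xbar H))) H'.1 hH'
  have hD6 := hqq (base hsheets xbar) (pullOf hsheets I 𝔡 hiso xbar H)
    (transportSub I 𝔡 (layerIso I 𝔡 hiso (τOf hsheets xbar) (quot (base hsheets xbar) (pullOf hsheets I 𝔡 hiso xbar H))).symm
      (isMonHom_layerIso_inv I 𝔡 hiso _ _) (layerIso_inv_comm I 𝔡 hiso _ _) H') hker'
  exact key.trans (congrArg (actOf S Kc 𝓜 w θ (τOf hsheets xbar)) hD6)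

end Machinery

/-! ### §1 THE FOUR ORGANS AND THE HEAD (continued: `stub_TRANSPORT`, head, junction) -/

section Stubs

-- the frame of the tree՚s `Stubs` section VERBATIM (incl. the auto-included instances `[IsGalois ℚ F] [FiniteDimensional F Fi] [IsGalois F Fi] [Finite G]`)
variable {F : Type} [Field F] [NumberField F] [IsCMField F] [IsGalois ℚ F] {ι₁ : F →+* ℂ}
    {Jstar : Matrix (Fin 2) (Fin 2) F}
    {K₀ : C5.OpenCompactSubgroup ↥(finAdelic ↥(maximalRealSubfield F) F (IsCMField.complexConj F) 2 Jstar)}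
    {S : RecordSystemGS F Jstar ι₁ K₀} {hU7ₛ : S.HeckeTranslateDefinedOver}
    {hJ : (Jstar.map (IsCMField.complexConj F))ᵀ = Jstar} {hJu : IsUnit Jstar}
    {Fi : Type} [Field Fi] [Algebra F Fi] [FiniteDimensional F Fi] [IsGalois F Fi] {Kc : C5.SmallLevel K₀} {G : Type} [Group G] [Finite G]
    {𝓜 : IntegralModel (𝓞 F) F ((thickening F Fi).obj (S.M.obj Kc))}
    {w : HeightOneSpectrum (𝓞 F)} {hw : (IsCMField.complexConj F) • w ≠ w} {h𝓨 : (𝓜.localise w).IsSmoothProper 1}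
    {θ : ActionOver (𝓜.localise w).total.hom ((Fi ≃ₐ[F] Fi) × G)}
    {e : Fi →ₐ[F] AlgebraicClosure (w.adicCompletion F)}

set_option maxHeartbeats 400000 in
/-- **THE LIGHT ROWS `SpecReadings` OF THE PAYMENT** (its own elaboration budget, D-line `blockOf` lesson): `sp` kept, `quot′`∕`transl′`∕`smap` the transported readings,
the five light laws from §E. [cite: Liu2021, Prop. D.8 p. 135, p. 137] -/
def specT (I : RGDInputsAt F ι₁ Jstar K₀ S hU7ₛ hJ hJu Fi Kc G 𝓜 w hw h𝓨 θ e) [ExpChar (geomResidueField w) I.pChar]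
    (𝔡 : ∀ xbar, DockAt I xbar)
    (quotΩ : ∀ y, LineOf I y → AlgPoints (S.M.obj Kc) (AlgebraicClosure (w.adicCompletion F)))
    (translΩ : AlgPoints (S.M.obj Kc) (AlgebraicClosure (w.adicCompletion F)) → AlgPoints (S.M.obj Kc) (AlgebraicClosure (w.adicCompletion F)))
    (sp : ∀ y, LineOf I y → SubOf I 𝔡 (red₀Of S Kc 𝓜 w h𝓨 e y))
    (quot : ∀ xbar, SubOf I 𝔡 xbar → AlgPoints (𝓜.localise w).reductionAt (geomResidueField w))
    (transl : AlgPoints (𝓜.localise w).reductionAt (geomResidueField w) → AlgPoints (𝓜.localise w).reductionAt (geomResidueField w))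
    (_hrq : RedQuotLaw I 𝔡 quotΩ sp quot) (_hrt : RedTranslLaw S Kc 𝓜 w h𝓨 e translΩ transl) (_hcan : CanonicalLineLaw I 𝔡 sp)
    (_hsheets : SheetDecompLaw S Kc 𝓜 w h𝓨 θ e) (_hiso : LayerIsoLaw I 𝔡)
    (_hdisj : haveI : AlgebraicGeometry.IsProper (𝓜.localise w).total.hom := h𝓨.2
      ∀ (β : Fi ≃ₐ[F] Fi) (P Q : AlgPoints (S.M.obj Kc) (AlgebraicClosure (w.adicCompletion F))),
        (𝓜.localise w).geomReductionMap (thickeningLift e (S.M.obj Kc) P) =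
          AlgPoints.map ((specialFibreFunctor w).map (Over.isoMk (θ.aut (β, 1)) (θ.aut_comp (β, 1))).hom :
              (𝓜.localise w).reductionAt ⟶ (𝓜.localise w).reductionAt)
            ((𝓜.localise w).geomReductionMap (thickeningLift e (S.M.obj Kc) Q)) → β = 1) :
    SpecReadings I 𝔡 quotΩ translΩ where
  sp := sp
  quot := quotT _hsheets I 𝔡 _hiso quot
  transl := translT _hsheets transl
  red_quotΩ := fun y L => red_quotΩ_quotT _hsheets I 𝔡 _hiso quot _hdisj _hrq y L
  red_translΩ := fun y => red_translΩ_translT _hsheets transl _hdisj _hrt y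
  canonicalLine₀ := _hcan
  smap := smapT I 𝔡 _hiso
  smap_kerF := fun τ xbar => smapT_kerFOf I 𝔡 _hiso τ xbar
  quot_smap := fun τ xbar H => quotT_smapT _hsheets I 𝔡 _hiso quot _hdisj τ xbar H

set_option linter.unusedSectionVars false in  -- ED. 3: the frame auto-includes `[FiniteDimensional F Fi] [IsGalois F Fi]`, unused by this organ
set_option maxHeartbeats 400000 in
/-- **`stub_TRANSPORT` — SHEET READINGS EXTEND `θ`-EQUIVARIANTLY TO ALL SPECIAL SHEETS** (assembly ∕ transport road): given readings `sp quot transl isogW₀` with their laws on the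
`e`-sheet (used there only), the sheet decomposition and the layer isos: decompose `x̄ = θ(τ,1)_s (red₀ y)` UNIQUELY (`_hdisj` + `θ.aut` a group homomorphism), keep the sheet values,
set `smap τ x̄ :=` ★ admissible transport along any layer iso (`AdmissibleIdealTransport.isHopfIdeal_and_finrank_and_map_le_comap_appTop`; = the combinatorial map since `SubOf x̄ ⊆
{kerF, the étale member}` by ★ `eq_kerFI_or_idealIsEtale_of_isAdm` + ★ `EtaleIdealEqPointsIdeal`, both preserved by every equivariant iso — so no cocycle is needed for `quot_smap`),
`smap_kerF :=` ★ `comap_appTop_ker_kerι_relFrobeniusOver`, and off the sheet `quot ∕ transl ∕ isogW₀ :=` the conjugates `θ(τ,1)_s ∘ (·) ∘ transport`; `IsogHomLaw`∕`IsogKerLaw` transport,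
D6 off the sheet = D6 at the sheet point transported (its second point `quot x̄₀ H` is on the sheet by `SpSurjLaw` + `RedQuotLaw`), `red_quotΩ`∕`red_translΩ`∕`canonicalLine₀` are the
sheet laws.  Why it might fail: it does not mathematically; the Lean cost is the dependent transport over `actOf (τσ) x̄ = actOf τ (actOf σ x̄)`.
[cite: RapoportSmithlingZhang2020Diagonal, Lemma 3.4–Prop. 3.7, pp. 12–14] [cite: SGA3I, VII_A 4.1] [cite: Liu2021, Prop. D.8 p. 135, p. 137] -/
theorem stub_TRANSPORT (I : RGDInputsAt F ι₁ Jstar K₀ S hU7ₛ hJ hJu Fi Kc G 𝓜 w hw h𝓨 θ e) [ExpChar (geomResidueField w) I.pChar]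
    (𝔡 : ∀ xbar, DockAt I xbar)
    (quotΩ : ∀ y, LineOf I y → AlgPoints (S.M.obj Kc) (AlgebraicClosure (w.adicCompletion F)))
    (translΩ : AlgPoints (S.M.obj Kc) (AlgebraicClosure (w.adicCompletion F)) → AlgPoints (S.M.obj Kc) (AlgebraicClosure (w.adicCompletion F)))
    (sp : ∀ y, LineOf I y → SubOf I 𝔡 (red₀Of S Kc 𝓜 w h𝓨 e y))
    (quot : ∀ xbar, SubOf I 𝔡 xbar → AlgPoints (𝓜.localise w).reductionAt (geomResidueField w))
    (transl : AlgPoints (𝓜.localise w).reductionAt (geomResidueField w) → AlgPoints (𝓜.localise w).reductionAt (geomResidueField w))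
    (isogW₀ : ∀ xbar (H : SubOf I 𝔡 xbar), (𝔡 xbar).G₀ ⟶ (𝔡 (quot xbar H)).G₀)
    (_hrq : RedQuotLaw I 𝔡 quotΩ sp quot) (_hrt : RedTranslLaw S Kc 𝓜 w h𝓨 e translΩ transl) (_hcan : CanonicalLineLaw I 𝔡 sp) (_hsurj : SpSurjLaw I 𝔡 sp)
    (_hhom : IsogHomLaw I 𝔡 quot isogW₀) (_hker : IsogKerLaw I 𝔡 quot isogW₀) (_hqq : QuotQuot₀Law I 𝔡 quot transl isogW₀)
    (_hsheets : SheetDecompLaw S Kc 𝓜 w h𝓨 θ e) (_hiso : LayerIsoLaw I 𝔡)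
    (_hdisj : haveI : AlgebraicGeometry.IsProper (𝓜.localise w).total.hom := h𝓨.2
      ∀ (β : Fi ≃ₐ[F] Fi) (P Q : AlgPoints (S.M.obj Kc) (AlgebraicClosure (w.adicCompletion F))),
        (𝓜.localise w).geomReductionMap (thickeningLift e (S.M.obj Kc) P) =
          AlgPoints.map ((specialFibreFunctor w).map (Over.isoMk (θ.aut (β, 1)) (θ.aut_comp (β, 1))).hom :
              (𝓜.localise w).reductionAt ⟶ (𝓜.localise w).reductionAt)
            ((𝓜.localise w).geomReductionMap (thickeningLift e (S.M.obj Kc) Q)) → β = 1) :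
    Nonempty (DownReadings I 𝔡 quotΩ translΩ) :=
  -- ED. 3: PAID (LA2-p01 (g0) payment 4d4dce1f, body verbatim)
  ⟨{ spec := specT I 𝔡 quotΩ translΩ sp quot transl _hrq _hrt _hcan _hsheets _hiso _hdisj
     isogW₀ := isogT _hsheets I 𝔡 _hiso quot isogW₀
     isogW₀_hom := isogHomLaw_isogT _hsheets I 𝔡 _hiso quot isogW₀ _hhom
     isogW₀_ker := isogKerLaw_isogT _hsheets I 𝔡 _hiso quot isogW₀ _hker
     quot_quot₀ := quotQuot₀Law_quotT _hsheets I 𝔡 _hiso quot transl isogW₀ _hdisj _hrq _hsurj _hqq }⟩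

set_option maxHeartbeats 400000 in
/-- **HEAD `stub_DOWN_of_organs`** — the tree socket `stub_DOWN` (`Lines/F0_P6a_DatumOfInputs.lean` ED. 1 :515) TOKEN FOR TOKEN, sorry-free over the four organs: the sheet
readings from `stub_SPEC`, the sheet decomposition from `stub_SHEETS`, the layer isos from `stub_LAYERISO`, assembled by `stub_TRANSPORT`.
[cite: Liu2021, Prop. D.8 p. 135, pp. 136–138] [cite: Tate1997FiniteFlatGroupSchemes, (3.7)] -/
theorem stub_DOWN_of_organs (I : RGDInputsAt F ι₁ Jstar K₀ S hU7ₛ hJ hJu Fi Kc G 𝓜 w hw h𝓨 θ e) [ExpChar (geomResidueField w) I.pChar]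
    (𝔡 : ∀ xbar, DockAt I xbar)
    (quotΩ : ∀ y, LineOf I y → AlgPoints (S.M.obj Kc) (AlgebraicClosure (w.adicCompletion F)))
    (translΩ : AlgPoints (S.M.obj Kc) (AlgebraicClosure (w.adicCompletion F)) → AlgPoints (S.M.obj Kc) (AlgebraicClosure (w.adicCompletion F)))
    (_hhecke : HeckeClause I quotΩ translΩ) (_hroof : RoofLink I quotΩ) (_hroof₂ : RoofLink₂ I translΩ)
    (_hθ : ∀ γ : Fi ≃ₐ[F] Fi,
       (genericFibre (HeightOneSpectrum.valuationSubringAtPrime F w) F).map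
             (Over.isoMk (θ.aut (γ, 1)) (θ.aut_comp (γ, 1))).hom ≫ (𝓜.localise w).genericIso'.hom
         = (𝓜.localise w).genericIso'.hom ≫
             (Over.isoMk ((thickeningGalAction (L := Fi) (S.M.obj Kc)).aut γ)
               ((thickeningGalAction (L := Fi) (S.M.obj Kc)).aut_comp γ)).hom)
    (_hunit : (UnitaryGroup.isUnit_placeForm Jstar hJu w).unit ∈ glInt 2 (w.adicCompletion F))
    (_hKc : UnitaryGroup.IsHyperspecialAt ↥(maximalRealSubfield F) F (IsCMField.complexConj F) 2 Jstar Kc.1.1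
      (w.under (𝓞 ↥(maximalRealSubfield F))))
    (_hdisj : haveI : AlgebraicGeometry.IsProper (𝓜.localise w).total.hom := h𝓨.2
      ∀ (β : Fi ≃ₐ[F] Fi) (P Q : AlgPoints (S.M.obj Kc) (AlgebraicClosure (w.adicCompletion F))),
        (𝓜.localise w).geomReductionMap (thickeningLift e (S.M.obj Kc) P) =
          AlgPoints.map ((specialFibreFunctor w).map (Over.isoMk (θ.aut (β, 1)) (θ.aut_comp (β, 1))).hom :
              (𝓜.localise w).reductionAt ⟶ (𝓜.localise w).reductionAt)
            ((𝓜.localise w).geomReductionMap (thickeningLift e (S.M.obj Kc) Q)) → β = 1) :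
    Nonempty (DownReadings I 𝔡 quotΩ translΩ) := by
  obtain ⟨sp, quot, transl, isogW₀, hrq, hrt, hcan, hsurj, hhom, hker, hqq⟩ :=
    stub_SPEC I 𝔡 quotΩ translΩ _hhecke _hroof _hroof₂ _hunit _hKc
  exact stub_TRANSPORT I 𝔡 quotΩ translΩ sp quot transl isogW₀ hrq hrt hcan hsurj hhom hker hqq
    (stub_SHEETS (h𝓨 := h𝓨) (e := e) _hθ) (stub_LAYERISO I 𝔡 _hθ) _hdisj

/-- JUNCTION CERTIFICATE (★ side): the head HAS the closed socket type `StubDOWNType` (★ `Theorems.F0P6aDatumOfInputsDefs`; = the type of the hub socket `stub_DOWN` binder for binder, ORDER-CERTIFIED hub-side). -/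
example : StubDOWNType := @stub_DOWN_of_organs

end Stubs

end Summit.HodgeConjecture.HodgeConjecture.Cruxes.HLiu418.F0P6aStubDOWN

end
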